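import Summits.ValiantsHypothesis.ValiantsHypothesis.Theorems.NewtonUnitEquationsTwoProductsTowerRecordDefs
import Summits.ValiantsHypothesis.ValiantsHypothesis.Theorems.NewtonUnitEquationsTwoProductsMomentRecordLetters

/-!
# R13-coeff — TOWER RECORD LEMMA (K2-valued) and the SIEGEL DEPENDENCES (K1, first half)

(2/6) Algebra of the tower moment polynomials; ★ `towerRecordLemma` (a record letter admits no VALUED polynomial relation `P·π_a = Σ_b Q_b·π_b`:
extract `[z^{k+s₀}]` of `P·ΔM(S) = Σ_b Q_b·ΔM(S − e_a + e_b)` — every competing pair is distinct from `(S,k)` and not lighter, hence dead);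
`siegel_dependence` (among `|κ|` polynomial vectors of degree `≤ D` with `|ι|(L+D+1) < |κ|(L+1)` a dependence with multipliers of degree `≤ L`;
convolution matrix + `LinearMap.ker_ne_bot_of_finrank_lt`) and its PRESCRIBED-SUPPORT form `siegel_dependence_supp` (levels in `E`, multipliers on `Λ`,
`|ι|·|Λ+E| < |κ|·|Λ|`).  `prod_pow_add_single`, `size_add_single`, `wtZ_ptZ_add_single` are the tree's ✓ `…MomentRecordLetters` ones BY NAME (imported).
Transplant (val-lit-p3 g18) of val-idea-37 g4's kernel-checked scratch `Cruxes/TwoProducts/TowerRecords_val_idea_37_g4.lean` (rev 3,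
sha16 988768bd6d8db99a, ns `ValIdea37g4T`; val-idea-crit-8 g2 VERDICT #19 + addendum: KEEP «R13-coeff», by-name GO for a verbatim transplant);
proofs verbatim by name, docstrings added, namespace = the tree's.  Helper on crux `stmt-ValiantsHypothesis-5906` (`TwoProducts`, line
`relation_ladder`); `--supports`, closes nothing by itself.  HONEST LABEL (crit-8 #19): COEFFICIENT-SIDE; the class rung it feeds (R13, dense
parallel towers on dissociated carriers) is a wider CLASS rung, inert as a hatch; F10's collinear digit towers NOT covered; `ResidualLawV24` ⟺
`PlanarCellBound`, the crux (stmt-5906), every `closes` binder and every summit statement UNMOVED; VP ≠ VNP is NOT proved.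
Credit: mathematics and kernel proofs val-idea-37 g4; critic of record val-idea-crit-8 g2.  No instances, no notation, no named facts. [folklore]
-/

set_option linter.dupNamespace false

noncomputable section

open Classical

namespace Summit.ValiantsHypothesis.ValiantsHypothesis.Theorems.NewtonUnitEquations.TwoProducts.TowerRecord

open scoped BigOperators
open Module Polynomial
open Summit.ValiantsHypothesis.ValiantsHypothesis.Theorems.NewtonUnitEquations.TwoProducts.FormalLogLinearisation
open Summit.ValiantsHypothesis.ValiantsHypothesis.Theorems.NewtonUnitEquations.TwoProducts.MomentRecord
open Summit.ValiantsHypothesis.ValiantsHypothesis.Theorems.NewtonUnitEquations.TwoProducts.PlanarCell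

variable {m n : ℕ}

/-! ## 2. Algebra of the tower moment polynomials -/

/-- Degree of the tower moment polynomial: `deg M(S) ≤ D·|S|`. [folklore] -/
theorem natDegree_momentPolyT_le (γ : Fin m → Fin n → ℂ[X]) (D : ℕ) (hγ : DegLe γ D) (S : Fin n → ℕ) :
    (momentPolyT γ S).natDegree ≤ D * size S := by
  unfold momentPolyT
  refine natDegree_sum_le_of_forall_le _ _ (fun j _ => ?_)
  refine (natDegree_prod_le _ _).trans ?_
  rw [size, Finset.mul_sum]
  refine Finset.sum_le_sum fun i _ => natDegree_pow_le.trans ?_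
  calc S i * (γ j i).natDegree ≤ S i * D := Nat.mul_le_mul_left _ (hγ j i)
    _ = D * S i := mul_comm _ _

/-- Layers above `D·|S|` vanish. [folklore] -/
theorem layerT_eq_zero_of_lt (γ γ' : Fin m → Fin n → ℂ[X]) (D : ℕ) (hγ : DegLe γ D) (hγ' : DegLe γ' D)
    {k : ℕ} {S : Fin n → ℕ} (h : D * size S < k) : layerT γ γ' k S = 0 := by
  unfold layerT
  rw [coeff_sub, coeff_eq_zero_of_natDegree_lt ((natDegree_momentPolyT_le γ D hγ S).trans_lt h),
    coeff_eq_zero_of_natDegree_lt ((natDegree_momentPolyT_le γ' D hγ' S).trans_lt h), sub_zero]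

/-- A live layer has `k ≤ D·|S|`. [folklore] -/
theorem le_of_layerT_ne_zero (γ γ' : Fin m → Fin n → ℂ[X]) (D : ℕ) (hγ : DegLe γ D) (hγ' : DegLe γ' D)
    {k : ℕ} {S : Fin n → ℕ} (h : layerT γ γ' k S ≠ 0) : k ≤ D * size S := by
  by_contra hlt
  exact h (layerT_eq_zero_of_lt γ γ' D hγ hγ' (not_le.mp hlt))

/-- `M(T + e_a) = Σ_j γ_{j a} Π_i γ_{j i}^{T_i}`. [folklore] -/
theorem momentPolyT_add_single (γ : Fin m → Fin n → ℂ[X]) (T : Fin n → ℕ) (a : Fin n) :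
    momentPolyT γ (T + Pi.single a 1) = ∑ j, γ j a * ∏ i, γ j i ^ T i :=
  Finset.sum_congr rfl fun j _ => prod_pow_add_single (fun i => γ j i) T a

/-- The weight of `(S,k)` is the weight of `(S,0)` plus `k·(ξ·d)`. [folklore] -/
theorem wtZ_ptZ_k (ξ : Fin 2 → ℝ) (x : Fin n → Expo) (d : Fin 2 → ℤ) (S : Fin n → ℕ) (k : ℕ) :
    wtZ ξ (ptZ x d S k) = wtZ ξ (ptZ x d S 0) + (k : ℝ) * wtZ ξ d := by
  have h : ∀ c, ptZ x d S k c = ptZ x d S 0 c + (k : ℤ) * d c := by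
    intro c
    simp [ptZ]
  simp only [wtZ, h]
  push_cast
  ring

/-- (★) a POLYNOMIAL relation `P·π_a = Σ_b Q_b·π_b` among the pencils propagates to the moment polynomials. -/
theorem momentPolyT_rel (γ : Fin m → Fin n → ℂ[X]) (a : Fin n) (P : ℂ[X]) (Q : Fin n → ℂ[X])
    (hrel : ∀ j, P * γ j a = ∑ b, Q b * γ j b) (T : Fin n → ℕ) :
    P * momentPolyT γ (T + Pi.single a 1) = ∑ b, Q b * momentPolyT γ (T + Pi.single b 1) := by
  have hR : ∀ b, Q b * momentPolyT γ (T + Pi.single b 1) = ∑ j, Q b * (γ j b * ∏ i, γ j i ^ T i) := by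
    intro b
    rw [momentPolyT_add_single, Finset.mul_sum]
  simp_rw [hR]
  rw [momentPolyT_add_single, Finset.mul_sum, Finset.sum_comm]
  refine Finset.sum_congr rfl fun j _ => ?_
  rw [← mul_assoc, hrel j, Finset.sum_mul]
  exact Finset.sum_congr rfl fun b _ => by ring

/-- (★) for the SIGNED moment polynomials: a relation holding for both pencils propagates to `ΔM`. [folklore] -/
theorem deltaT_rel (γ γ' : Fin m → Fin n → ℂ[X]) (a : Fin n) (P : ℂ[X]) (Q : Fin n → ℂ[X])
    (hrel : ∀ j, P * γ j a = ∑ b, Q b * γ j b) (hrel' : ∀ j, P * γ' j a = ∑ b, Q b * γ' j b) (T : Fin n → ℕ) :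
    P * (momentPolyT γ (T + Pi.single a 1) - momentPolyT γ' (T + Pi.single a 1)) =
      ∑ b, Q b * (momentPolyT γ (T + Pi.single b 1) - momentPolyT γ' (T + Pi.single b 1)) := by
  rw [mul_sub, momentPolyT_rel γ a P Q hrel T, momentPolyT_rel γ' a P Q hrel' T, ← Finset.sum_sub_distrib]
  exact Finset.sum_congr rfl fun b _ => by ring

/-! ## 3. K2-valued: THE TOWER RECORD LEMMA (PROVED) -/

/-- **Tower record lemma.**  A record letter admits no valued polynomial relation. -/
theorem towerRecordLemma (γ γ' : Fin m → Fin n → ℂ[X]) (x : Fin n → Expo) (d : Fin 2 → ℤ) (m' : ℕ)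
    (ξ : Fin 2 → ℝ) (S : Fin n → ℕ) (k : ℕ) (hrec : IsRecordT γ γ' x d m' ξ (S, k)) (a : Fin n) (hSa : 0 < S a)
    (P : ℂ[X]) (Q : Fin n → ℂ[X]) (s₀ : ℕ) (hs₀ : P.coeff s₀ ≠ 0) (hQa : Q a = 0)
    (hrel : ∀ j, P * γ j a = ∑ b, Q b * γ j b) (hrel' : ∀ j, P * γ' j a = ∑ b, Q b * γ' j b)
    (hP : ∀ s ∈ P.support, 0 ≤ ((s₀ : ℝ) - s) * wtZ ξ d)
    (hQ : ∀ b, ∀ s ∈ (Q b).support, 0 ≤ wt ξ (x b) - wt ξ (x a) + ((s₀ : ℝ) - s) * wtZ ξ d) : False := by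
  -- `S = T + e_a`
  obtain ⟨T, rfl⟩ : ∃ T : Fin n → ℕ, S = T + Pi.single a 1 := by
    refine ⟨Function.update S a (S a - 1), funext fun i => ?_⟩
    by_cases hi : i = a
    · subst hi
      simp [Nat.sub_add_cancel hSa]
    · simp [hi]
  have hlive : (T + Pi.single a 1, k) ∈ liveT γ γ' m' := hrec.1
  simp only [liveT, Set.mem_setOf_eq] at hlive
  obtain ⟨hsizeS, hlayerS⟩ := hlive
  have hbeat := hrec.2
  -- a shallow pair distinct from the record and not lighter is dead
  have dead : ∀ (S' : Fin n → ℕ) (k' : ℕ), size S' ≤ m' → (S', k') ≠ (T + Pi.single a 1, k) →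
      wtZ ξ (ptZ x d (T + Pi.single a 1) k) ≤ wtZ ξ (ptZ x d S' k') → layerT γ γ' k' S' = 0 := by
    intro S' k' hs hne hle
    by_contra h
    have hq : (S', k') ∈ liveT γ γ' m' := by
      simp only [liveT, Set.mem_setOf_eq]
      exact ⟨hs, h⟩
    exact absurd (hbeat (S', k') hq hne) (not_lt.mpr hle)
  -- coefficient `k + s₀` of `P · ΔM(S)`
  have lhs : (P * (momentPolyT γ (T + Pi.single a 1) - momentPolyT γ' (T + Pi.single a 1))).coeff (k + s₀) =
      P.coeff s₀ * layerT γ γ' k (T + Pi.single a 1) := by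
    rw [coeff_mul, Finset.sum_eq_single (s₀, k)]
    · rfl
    · rintro ⟨s, k'⟩ hmem hne
      rw [Finset.HasAntidiagonal.mem_antidiagonal] at hmem
      by_cases hs : P.coeff s = 0
      · rw [hs, zero_mul]
      · have hcast : (k' : ℝ) - k = (s₀ : ℝ) - s := by
          have h := congrArg (Nat.cast : ℕ → ℝ) hmem
          push_cast at h
          linarith
        have hkk : k' ≠ k := by
          intro h
          subst h
          have : s = s₀ := by omega
          exact hne (by rw [this])
        have h0 : layerT γ γ' k' (T + Pi.single a 1) = 0 := by
          refine dead _ _ hsizeS (fun h => hkk (congrArg Prod.snd h)) ?_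
          rw [wtZ_ptZ_k ξ x d _ k, wtZ_ptZ_k ξ x d _ k']
          have := hP s (mem_support_iff.mpr hs)
          have hprod : ((k' : ℝ) - k) * wtZ ξ d = ((s₀ : ℝ) - s) * wtZ ξ d := by rw [hcast]
          have hexp : ((k' : ℝ) - k) * wtZ ξ d = (k' : ℝ) * wtZ ξ d - (k : ℝ) * wtZ ξ d := by ring
          linarith [hprod, hexp, this]
        change P.coeff s * layerT γ γ' k' (T + Pi.single a 1) = 0
        rw [h0, mul_zero]
    · intro hnot
      exact absurd (Finset.HasAntidiagonal.mem_antidiagonal.mpr (by simp only; omega)) hnot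
  -- coefficient `k + s₀` of the right-hand side vanishes
  have rhs : (∑ b, Q b * (momentPolyT γ (T + Pi.single b 1) - momentPolyT γ' (T + Pi.single b 1))).coeff (k + s₀) = 0 := by
    rw [finsetSum_coeff]
    refine Finset.sum_eq_zero fun b _ => ?_
    rw [coeff_mul]
    refine Finset.sum_eq_zero fun y hmem => ?_
    obtain ⟨s, k'⟩ := y
    rw [Finset.HasAntidiagonal.mem_antidiagonal] at hmem
    by_cases hs : (Q b).coeff s = 0
    · rw [hs, zero_mul]
    · have hba : b ≠ a := by
        rintro rfl
        rw [hQa, coeff_zero] at hs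
        exact hs rfl
      have hcast : (k' : ℝ) - k = (s₀ : ℝ) - s := by
        have h := congrArg (Nat.cast : ℕ → ℝ) hmem
        push_cast at h
        linarith
      have h0 : layerT γ γ' k' (T + Pi.single b 1) = 0 := by
        refine dead _ _ (by rw [size_add_single] at hsizeS ⊢; exact hsizeS) ?_ ?_
        · intro h
          have := congrFun (congrArg Prod.fst h) a
          simp [hba] at this
        · rw [wtZ_ptZ_k ξ x d _ k, wtZ_ptZ_k ξ x d _ k', wtZ_ptZ_add_single, wtZ_ptZ_add_single]
          have := hQ b s (mem_support_iff.mpr hs)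
          have hprod : ((k' : ℝ) - k) * wtZ ξ d = ((s₀ : ℝ) - s) * wtZ ξ d := by rw [hcast]
          have hexp : ((k' : ℝ) - k) * wtZ ξ d = (k' : ℝ) * wtZ ξ d - (k : ℝ) * wtZ ξ d := by ring
          linarith [hprod, hexp, this]
      change (Q b).coeff s * layerT γ γ' k' (T + Pi.single b 1) = 0
      rw [h0, mul_zero]
  have key : P.coeff s₀ * layerT γ γ' k (T + Pi.single a 1) = 0 := by
    rw [← lhs, deltaT_rel γ γ' a P Q hrel hrel' T, rhs]
  exact hlayerS ((mul_eq_zero.mp key).resolve_left hs₀)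

/-! ## 4. K1, first half: a SIEGEL DEPENDENCE of bounded degree (dimension count, PROVED) -/

/-- Among `|κ|` polynomial vectors `π_b ∈ ℂ[X]^ι` of degree `≤ D` with `|ι| (L+D+1) < |κ| (L+1)` there is a dependence
`Σ_b λ_b π_b = 0`, `deg λ_b ≤ L`, not all `λ_b = 0`. -/
theorem siegel_dependence {ι κ : Type*} [Fintype ι] [Fintype κ] [DecidableEq ι] [DecidableEq κ]
    (π : κ → ι → ℂ[X]) (D L : ℕ) (hdeg : ∀ b i, (π b i).natDegree ≤ D)
    (hcard : Fintype.card ι * (L + D + 1) < Fintype.card κ * (L + 1)) :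
    ∃ lam : κ → ℂ[X], (∃ b, lam b ≠ 0) ∧ (∀ b, (lam b).natDegree ≤ L) ∧ ∀ i, ∑ b, lam b * π b i = 0 := by
  let A : Matrix (ι × Fin (L + D + 1)) (κ × Fin (L + 1)) ℂ :=
    fun ie bs => if (bs.2 : ℕ) ≤ (ie.2 : ℕ) then (π bs.1 ie.1).coeff ((ie.2 : ℕ) - (bs.2 : ℕ)) else 0
  have hlt : finrank ℂ (ι × Fin (L + D + 1) → ℂ) < finrank ℂ (κ × Fin (L + 1) → ℂ) := by
    simp only [Module.finrank_fintype_fun_eq_card, Fintype.card_prod, Fintype.card_fin]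
    exact hcard
  have hker := LinearMap.ker_ne_bot_of_finrank_lt (f := Matrix.mulVecLin A) hlt
  obtain ⟨c, hc, hc0⟩ := (Submodule.ne_bot_iff _).mp hker
  rw [LinearMap.mem_ker, Matrix.mulVecLin_apply] at hc
  refine ⟨fun b => ∑ s : Fin (L + 1), C (c (b, s)) * X ^ (s : ℕ), ?_, ?_, ?_⟩
  · obtain ⟨⟨b, s⟩, hbs⟩ : ∃ bs, c bs ≠ 0 := by
      by_contra h
      push Not at h
      exact hc0 (funext h)
    refine ⟨b, fun h0 => hbs ?_⟩
    have h1 := congrArg (fun p : ℂ[X] => p.coeff (s : ℕ)) h0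
    simp only [finsetSum_coeff, coeff_C_mul_X_pow, coeff_zero] at h1
    rw [Finset.sum_eq_single s] at h1
    · simpa using h1
    · intro s' _ hs'
      rw [if_neg]
      exact fun h => hs' (Fin.ext h).symm
    · intro h
      exact absurd (Finset.mem_univ s) h
  · intro b
    refine natDegree_sum_le_of_forall_le _ _ fun s _ => ?_
    exact (natDegree_C_mul_X_pow_le (c (b, s)) s).trans (Nat.le_of_lt_succ s.is_lt)
  · intro i
    ext e
    rw [finsetSum_coeff, coeff_zero]
    have hterm : ∀ b, ((∑ s : Fin (L + 1), C (c (b, s)) * X ^ (s : ℕ)) * π b i).coeff e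
        = ∑ s : Fin (L + 1), (if (s : ℕ) ≤ e then c (b, s) * (π b i).coeff (e - s) else 0) := by
      intro b
      rw [Finset.sum_mul, finsetSum_coeff]
      refine Finset.sum_congr rfl fun s _ => ?_
      rw [mul_assoc, coeff_C_mul, coeff_X_pow_mul']
      split_ifs <;> simp
    simp_rw [hterm]
    by_cases he : e < L + D + 1
    · have h1 := congrFun hc (i, ⟨e, he⟩)
      simp only [Matrix.mulVec, dotProduct, Pi.zero_apply] at h1
      refine Eq.trans ?_ h1
      rw [Fintype.sum_prod_type]
      refine Finset.sum_congr rfl fun b _ => Finset.sum_congr rfl fun s _ => ?_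
      simp only [A]
      split_ifs <;> ring
    · refine Finset.sum_eq_zero fun b _ => Finset.sum_eq_zero fun s _ => ?_
      split_ifs with hs
      · rw [coeff_eq_zero_of_natDegree_lt, mul_zero]
        calc (π b i).natDegree ≤ D := hdeg b i
          _ < e - s := by have := s.is_lt; omega
      · rfl

/-! ## 4b. Siegel dependence with prescribed support (sparse levels; source §10) -/

section Supp
open Pointwise

/-- Siegel dependence with PRESCRIBED SUPPORT: pencils with levels in `E`, multipliers supported on `Λ`, `|ι|·|Λ+E| < |κ|·|Λ|`. -/
theorem siegel_dependence_supp {ι κ : Type*} [Fintype ι] [Fintype κ] [DecidableEq ι] [DecidableEq κ]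
    (π : κ → ι → ℂ[X]) (E Λ : Finset ℕ) (hE : ∀ b i, (π b i).support ⊆ E)
    (hcard : Fintype.card ι * (Λ + E).card < Fintype.card κ * Λ.card) :
    ∃ lam : κ → ℂ[X], (∃ b, lam b ≠ 0) ∧ (∀ b, (lam b).support ⊆ Λ) ∧ ∀ i, ∑ b, lam b * π b i = 0 := by
  let A : Matrix (ι × ↥(Λ + E)) (κ × ↥Λ) ℂ :=
    fun ie bs => if ((bs.2 : ℕ)) ≤ ((ie.2 : ℕ)) then (π bs.1 ie.1).coeff ((ie.2 : ℕ) - (bs.2 : ℕ)) else 0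
  have hlt : finrank ℂ (ι × ↥(Λ + E) → ℂ) < finrank ℂ (κ × ↥Λ → ℂ) := by
    simp only [Module.finrank_fintype_fun_eq_card, Fintype.card_prod, Fintype.card_coe]
    exact hcard
  have hker := LinearMap.ker_ne_bot_of_finrank_lt (f := Matrix.mulVecLin A) hlt
  obtain ⟨c, hc, hc0⟩ := (Submodule.ne_bot_iff _).mp hker
  rw [LinearMap.mem_ker, Matrix.mulVecLin_apply] at hc
  refine ⟨fun b => ∑ s : ↥Λ, C (c (b, s)) * X ^ (s : ℕ), ?_, ?_, ?_⟩
  · obtain ⟨⟨b, s⟩, hbs⟩ : ∃ bs, c bs ≠ 0 := by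
      by_contra h
      push Not at h
      exact hc0 (funext h)
    refine ⟨b, fun h0 => hbs ?_⟩
    have h1 := congrArg (fun p : ℂ[X] => p.coeff (s : ℕ)) h0
    simp only [finsetSum_coeff, coeff_C_mul_X_pow, coeff_zero] at h1
    rw [Finset.sum_eq_single s] at h1
    · simpa using h1
    · intro s' _ hs'
      rw [if_neg]
      exact fun h => hs' (Subtype.ext h).symm
    · intro h
      exact absurd (Finset.mem_univ s) h
  · intro b e he
    rw [Polynomial.mem_support_iff, finsetSum_coeff] at he
    by_contra heΛ
    apply he
    refine Finset.sum_eq_zero fun s _ => ?_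
    rw [coeff_C_mul_X_pow, if_neg]
    intro h
    exact heΛ (h ▸ s.property)
  · intro i
    ext e
    rw [finsetSum_coeff, coeff_zero]
    have hterm : ∀ b, ((∑ s : ↥Λ, C (c (b, s)) * X ^ (s : ℕ)) * π b i).coeff e
        = ∑ s : ↥Λ, (if (s : ℕ) ≤ e then c (b, s) * (π b i).coeff (e - s) else 0) := by
      intro b
      rw [Finset.sum_mul, finsetSum_coeff]
      refine Finset.sum_congr rfl fun s _ => ?_
      rw [mul_assoc, coeff_C_mul, coeff_X_pow_mul']
      split_ifs <;> simp
    simp_rw [hterm]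
    by_cases he : e ∈ Λ + E
    · have h1 := congrFun hc (i, ⟨e, he⟩)
      simp only [Matrix.mulVec, dotProduct, Pi.zero_apply] at h1
      refine Eq.trans ?_ h1
      rw [Fintype.sum_prod_type]
      refine Finset.sum_congr rfl fun b _ => Finset.sum_congr rfl fun s _ => ?_
      simp only [A]
      split_ifs <;> ring
    · refine Finset.sum_eq_zero fun b _ => Finset.sum_eq_zero fun s _ => ?_
      split_ifs with hs
      · by_cases hco : (π b i).coeff (e - s) = 0
        · rw [hco, mul_zero]
        · exfalso
          have hmem : e - (s : ℕ) ∈ E := hE b i (mem_support_iff.mpr hco)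
          have : (s : ℕ) + (e - s) ∈ Λ + E := Finset.add_mem_add s.property hmem
          rw [Nat.add_sub_cancel' hs] at this
          exact he this
      · rfl

end Supp

end Summit.ValiantsHypothesis.ValiantsHypothesis.Theorems.NewtonUnitEquations.TwoProducts.TowerRecord

end
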